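import Mathlib
import Summits.Ventures.PercRepro2.CutVertexCubic

/-!
# The cut vertex separating the roots, III: (HCOV) from the symmetrised pieces (blind cell
PercRepro2, p3 g2, 2026-08-25; `proofs/P3-BRIDGE.md` §10.8)

`Gc = Σ_t pH t₁ pH t₂ pH t₃ · Wt t` (`Gc_eq_sum_hstates`) and the weights `pH t₁ pH t₂ pH t₃` are
invariant under permuting `t`, so `6 · Gc = Σ_t pH t₁ pH t₂ pH t₃ · Wsym t` with `Wsym t` the sum of
`Wt` over the six orderings of `t` (`six_mul_sum_eq`) — the `l`-side form of the MULTISET of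
markings.  Hence **`Gc_nonneg_of_cutVertex_of_sym`**: (HCOV) holds on every cut-vertex instance whose
35 symmetrised pieces are nonnegative.  The pieces are the polynomials `W_M` of `P3-BRIDGE.md`
§10.8 in the `l`-side atoms; their nonnegativity is the content of the exact certificates there
(products of BHK06 1.1 / 1.3 / 1.4 and Harris slacks) — the Lean of the pieces is the next file.
Own work; standard axioms.
-/

namespace Summit.Ventures.PercRepro2

open UnionCluster

namespace CovForm

namespace RootBridge

open OneTyped

section Reduction

open Classical

variable {V : Type*} {E : Type*} [Fintype E] [DecidableEq E] {R : Type*}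
  [Field R] [LinearOrder R] [IsStrictOrderedRing R]
variable (p : E → R) (ends : E → Sym2 V) (o a₁ a₂ a₃ b c : V) (VL VH : Set V)

/-- The symmetrised piece: `Wt` summed over the six orderings of the markings. -/
noncomputable def Wsym (t₁ t₂ t₃ : HState) : R :=
  Wt p ends o a₁ b c VL t₁ t₂ t₃ + Wt p ends o a₁ b c VL t₁ t₃ t₂ + Wt p ends o a₁ b c VL t₂ t₁ t₃ +
    Wt p ends o a₁ b c VL t₂ t₃ t₁ + Wt p ends o a₁ b c VL t₃ t₁ t₂ + Wt p ends o a₁ b c VL t₃ t₂ t₁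

/-- The `h`-state law is nonnegative. -/
lemma pH_nonneg (hp : IsProbVec p) (t : HState) : 0 ≤ pH p ends a₂ a₃ c VH t := by
  refine expect_nonneg hp fun x => ?_
  unfold hInd
  split_ifs <;> norm_num

omit [Fintype E] [DecidableEq E] [LinearOrder R] [IsStrictOrderedRing R] in
/-- Swapping the last two summation variables. -/
lemma sum3_swap23 (g : HState → HState → HState → R) :
    (∑ a : HState, ∑ b : HState, ∑ c : HState, g a b c) = ∑ a : HState, ∑ b : HState, ∑ c : HState, g a c b :=
  Finset.sum_congr rfl fun _ _ => Finset.sum_comm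

omit [Fintype E] [DecidableEq E] [LinearOrder R] [IsStrictOrderedRing R] in
/-- Swapping the first two summation variables. -/
lemma sum3_swap12 (g : HState → HState → HState → R) :
    (∑ a : HState, ∑ b : HState, ∑ c : HState, g a b c) = ∑ a : HState, ∑ b : HState, ∑ c : HState, g b a c :=
  Finset.sum_comm

omit [LinearOrder R] [IsStrictOrderedRing R] in
/-- **Six times the conditioned sum is the sum over the symmetrised pieces.** -/
lemma six_mul_sum_eq :
    6 * (∑ t₁ : HState, ∑ t₂ : HState, ∑ t₃ : HState,
        pH p ends a₂ a₃ c VH t₁ * pH p ends a₂ a₃ c VH t₂ * pH p ends a₂ a₃ c VH t₃ *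
          Wt p ends o a₁ b c VL t₁ t₂ t₃) =
      ∑ t₁ : HState, ∑ t₂ : HState, ∑ t₃ : HState,
        pH p ends a₂ a₃ c VH t₁ * pH p ends a₂ a₃ c VH t₂ * pH p ends a₂ a₃ c VH t₃ *
          Wsym p ends o a₁ b c VL t₁ t₂ t₃ := by
  set q : HState → R := pH p ends a₂ a₃ c VH with hq
  set W : HState → HState → HState → R := Wt p ends o a₁ b c VL with hW
  -- the six reindexed sums
  have e132 : (∑ t₁ : HState, ∑ t₂ : HState, ∑ t₃ : HState, q t₁ * q t₂ * q t₃ * W t₁ t₃ t₂) =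
      ∑ t₁ : HState, ∑ t₂ : HState, ∑ t₃ : HState, q t₁ * q t₂ * q t₃ * W t₁ t₂ t₃ := by
    rw [sum3_swap23 (fun a b c => q a * q b * q c * W a c b)]
    refine Finset.sum_congr rfl fun a _ => Finset.sum_congr rfl fun b _ => Finset.sum_congr rfl fun c _ => ?_
    ring
  have e213 : (∑ t₁ : HState, ∑ t₂ : HState, ∑ t₃ : HState, q t₁ * q t₂ * q t₃ * W t₂ t₁ t₃) =
      ∑ t₁ : HState, ∑ t₂ : HState, ∑ t₃ : HState, q t₁ * q t₂ * q t₃ * W t₁ t₂ t₃ := by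
    rw [sum3_swap12 (fun a b c => q a * q b * q c * W b a c)]
    refine Finset.sum_congr rfl fun a _ => Finset.sum_congr rfl fun b _ => Finset.sum_congr rfl fun c _ => ?_
    ring
  have e231 : (∑ t₁ : HState, ∑ t₂ : HState, ∑ t₃ : HState, q t₁ * q t₂ * q t₃ * W t₂ t₃ t₁) =
      ∑ t₁ : HState, ∑ t₂ : HState, ∑ t₃ : HState, q t₁ * q t₂ * q t₃ * W t₁ t₂ t₃ := by
    rw [sum3_swap12 (fun a b c => q a * q b * q c * W b c a)]
    rw [sum3_swap23 (fun a b c => q b * q a * q c * W a c b)]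
    refine Finset.sum_congr rfl fun a _ => Finset.sum_congr rfl fun b _ => Finset.sum_congr rfl fun c _ => ?_
    ring
  have e312 : (∑ t₁ : HState, ∑ t₂ : HState, ∑ t₃ : HState, q t₁ * q t₂ * q t₃ * W t₃ t₁ t₂) =
      ∑ t₁ : HState, ∑ t₂ : HState, ∑ t₃ : HState, q t₁ * q t₂ * q t₃ * W t₁ t₂ t₃ := by
    rw [sum3_swap23 (fun a b c => q a * q b * q c * W c a b)]
    rw [sum3_swap12 (fun a b c => q a * q c * q b * W b a c)]
    refine Finset.sum_congr rfl fun a _ => Finset.sum_congr rfl fun b _ => Finset.sum_congr rfl fun c _ => ?_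
    ring
  have e321 : (∑ t₁ : HState, ∑ t₂ : HState, ∑ t₃ : HState, q t₁ * q t₂ * q t₃ * W t₃ t₂ t₁) =
      ∑ t₁ : HState, ∑ t₂ : HState, ∑ t₃ : HState, q t₁ * q t₂ * q t₃ * W t₁ t₂ t₃ := by
    rw [sum3_swap23 (fun a b c => q a * q b * q c * W c b a)]
    rw [sum3_swap12 (fun a b c => q a * q c * q b * W b c a)]
    rw [sum3_swap23 (fun a b c => q b * q c * q a * W a c b)]
    refine Finset.sum_congr rfl fun a _ => Finset.sum_congr rfl fun b _ => Finset.sum_congr rfl fun c _ => ?_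
    ring
  have expand : (∑ t₁ : HState, ∑ t₂ : HState, ∑ t₃ : HState, q t₁ * q t₂ * q t₃ * Wsym p ends o a₁ b c VL t₁ t₂ t₃) =
      (∑ t₁ : HState, ∑ t₂ : HState, ∑ t₃ : HState, q t₁ * q t₂ * q t₃ * W t₁ t₂ t₃) +
      (∑ t₁ : HState, ∑ t₂ : HState, ∑ t₃ : HState, q t₁ * q t₂ * q t₃ * W t₁ t₃ t₂) +
      (∑ t₁ : HState, ∑ t₂ : HState, ∑ t₃ : HState, q t₁ * q t₂ * q t₃ * W t₂ t₁ t₃) +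
      (∑ t₁ : HState, ∑ t₂ : HState, ∑ t₃ : HState, q t₁ * q t₂ * q t₃ * W t₂ t₃ t₁) +
      (∑ t₁ : HState, ∑ t₂ : HState, ∑ t₃ : HState, q t₁ * q t₂ * q t₃ * W t₃ t₁ t₂) +
      (∑ t₁ : HState, ∑ t₂ : HState, ∑ t₃ : HState, q t₁ * q t₂ * q t₃ * W t₃ t₂ t₁) := by
    simp only [Wsym, mul_add, Finset.sum_add_distrib]
    rw [← hW]
  rw [expand, e132, e213, e231, e312, e321]
  ring

/-- **(HCOV) on a cut-vertex instance from its 35 symmetrised pieces.** -/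
theorem Gc_nonneg_of_cutVertex_of_sym (hp : IsProbVec p) {VL VH : Set V}
    (h : CutVertex ends o a₁ a₂ a₃ b c VL VH)
    (hW : ∀ t₁ t₂ t₃ : HState, 0 ≤ Wsym p ends o a₁ b c VL t₁ t₂ t₃) :
    0 ≤ Gc p ends o a₁ a₂ a₃ b := by
  have h6 : 0 ≤ 6 * Gc p ends o a₁ a₂ a₃ b := by
    rw [Gc_eq_sum_hstates p ends o a₁ a₂ a₃ b c h, six_mul_sum_eq]
    refine Finset.sum_nonneg fun t₁ _ => Finset.sum_nonneg fun t₂ _ => Finset.sum_nonneg fun t₃ _ => ?_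
    exact mul_nonneg (mul_nonneg (mul_nonneg (pH_nonneg p ends a₂ a₃ c VH hp t₁)
      (pH_nonneg p ends a₂ a₃ c VH hp t₂)) (pH_nonneg p ends a₂ a₃ c VH hp t₃)) (hW t₁ t₂ t₃)
  have h6' : (0 : R) < 6 := by norm_num
  exact (mul_nonneg_iff_of_pos_left h6').1 h6

end Reduction

end RootBridge

end CovForm

end Summit.Ventures.PercRepro2
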